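import Mathlib.Analysis.SpecialFunctions.Integrals.Basic
import Mathlib.MeasureTheory.Integral.IntervalIntegral.FundThmCalculus
import Mathlib.Analysis.SpecialFunctions.Trigonometric.Deriv
import Mathlib.Analysis.SpecialFunctions.ExpDeriv
import HarnessLib

/-!
# The per-link lattice Schwinger–Dyson identity for compact U(1), any number of plaquettes through the link

HONEST FRAMING: exact (Metropolis-corrected) sampling algorithms for lattice gauge theory;
figures of merit are autocorrelation/cost numbers at stated couplings and volumes; no
continuum-physics claim.

Venture `LatticeQCDFlow` (cell pub-lqcd), sub-topic `Scoring`; FANOUT row 10 (`eng-equiv`, the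
author of the engine-side observable `latflow.equiv.sd` / `latflow.flows_jax.sd_jax`).  NEW WORK of the
cell (our own elementary proof); it generalises row 11's one-plaquette file
`SchwingerDysonOnePlaquette.lean` (`integral_sdResidual_onePlaquette` is the case of ONE plaquette with
zero environment) to the statement the engine and the scorers' key-free `sd_re` identity test
(arbiter ruling L2-A15 (b), 2026-08-21) actually use.

## The statement

Fix a link `l` of a periodic (or any) lattice with the Wilson plaquette action
`S = −β Σ_P cos θ_P` for compact U(1).  Orient every plaquette `P` containing `l` so that the link
angle `θ = θ_l` enters with coefficient `+1`: then `θ_P = θ + a_P`, where the "environment"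
`a_P` (the rest of the plaquette) does not depend on `θ`; plaquettes not containing `l` contribute a
factor independent of `θ`.  Conditionally on ALL other links, the law of `θ` on `[0, 2π]` has density
proportional to the link weight `E(θ) = exp(β Σ_{P ∋ l} cos(θ + a_P))`.  For a plaquette `P₀ ∋ l` the
engine's residual is (`latflow.equiv.sd` eq. (4), `R = e^{iθ_{P₀}}(1 + iβ Σ_{P∋l} sin θ_P)`):

* real part `Re R = cos θ_{P₀} − β (Σ_{P ∋ l} sin θ_P) sin θ_{P₀}`,
* imaginary part `Im R = sin θ_{P₀} + β (Σ_{P ∋ l} sin θ_P) cos θ_{P₀}`.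

**Theorems** (for every real `β`, every finite index set `J` of plaquettes through the link, every
environment `a : J → ℝ`, every `P₀`):

* `integral_sdRe_link` — `∫_0^{2π} Re R(θ) · E(θ) dθ = 0`,
* `integral_sdIm_link` — `∫_0^{2π} Im R(θ) · E(θ) dθ = 0`,
* `integral_sdRe_linkMean` — the same for the engine's per-link average over `P₀ ∈ J`,
* `linkExpect_sdRe_eq_zero` / `linkExpect_sdIm_eq_zero` — the normalised conditional expectations vanish
  (`Z_l = ∫_0^{2π} E > 0`).

Proof: `d/dθ [sin(θ + a_{P₀}) E(θ)] = Re R · E` and `d/dθ [cos(θ + a_{P₀}) E(θ)] = −Im R · E`; both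
antiderivatives are `2π`-periodic, so the fundamental theorem of calculus gives zero.  This is the
per-link (left-)Haar invariance of the U(1) Wilson measure; since it holds conditionally on every
environment, the UNconditional lattice expectation of `R` (and of any average of `R` over links and
plaquettes, which is what a chain records as `obs_sd_re` / `obs_sd_im`) is zero at every `β`, volume,
dimension (`|J| = 2(D−1)` on a hypercubic lattice) and boundary condition — by integrating this
identity against the law of the environment (Fubini/tower property; not re-typed here).

What is NOT here: the non-abelian `SU(N)` statement (row 10's eq. (3): left-invariant vector fields on
`SU(N)`), and any claim about the statistical power of the test (measured by kit canaries, not typed).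
-/

namespace Summit.Ventures.LatticeQCDFlow.Scoring

open Real MeasureTheory intervalIntegral Finset

variable {ι : Type*}

/-- The conditional (one-link) Boltzmann weight of the plaquettes through the link:
`E(θ) = exp(β Σ_{P ∈ J} cos(θ + a P))`. -/
noncomputable def linkWeight (β : ℝ) (J : Finset ι) (a : ι → ℝ) (θ : ℝ) : ℝ :=
  Real.exp (β * ∑ P ∈ J, Real.cos (θ + a P))

/-- The sum of the sines of the (oriented) plaquette angles through the link: `Σ_{P ∈ J} sin(θ + a P)`. -/
noncomputable def linkSinSum (J : Finset ι) (a : ι → ℝ) (θ : ℝ) : ℝ :=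
  ∑ P ∈ J, Real.sin (θ + a P)

/-- Real part of the U(1) Schwinger–Dyson residual for the pair (link, `P₀`), times the link weight:
`[cos(θ + a P₀) − β (Σ_P sin(θ + a P)) sin(θ + a P₀)] · E(θ)`. -/
noncomputable def sdReDensity (β : ℝ) (J : Finset ι) (a : ι → ℝ) (P₀ : ι) (θ : ℝ) : ℝ :=
  (Real.cos (θ + a P₀) - β * linkSinSum J a θ * Real.sin (θ + a P₀)) * linkWeight β J a θ

/-- Imaginary part of the U(1) Schwinger–Dyson residual for the pair (link, `P₀`), times the link weight:
`[sin(θ + a P₀) + β (Σ_P sin(θ + a P)) cos(θ + a P₀)] · E(θ)`. -/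
noncomputable def sdImDensity (β : ℝ) (J : Finset ι) (a : ι → ℝ) (P₀ : ι) (θ : ℝ) : ℝ :=
  (Real.sin (θ + a P₀) + β * linkSinSum J a θ * Real.cos (θ + a P₀)) * linkWeight β J a θ

/-- `d/dθ [β Σ_P cos(θ + a P)] = β Σ_P (−sin(θ + a P))`. -/
theorem hasDerivAt_betaCosSum (β : ℝ) (J : Finset ι) (a : ι → ℝ) (θ : ℝ) :
    HasDerivAt (fun x => β * ∑ P ∈ J, Real.cos (x + a P)) (β * ∑ P ∈ J, -Real.sin (θ + a P)) θ := by
  have hP : ∀ P ∈ J, HasDerivAt (fun x => Real.cos (x + a P)) (-Real.sin (θ + a P)) θ := by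
    intro P _
    have h : HasDerivAt (fun x => Real.cos (x + a P)) (-Real.sin (θ + a P) * 1) θ :=
      ((hasDerivAt_id θ).add_const (a P)).cos
    simpa using h
  exact (HasDerivAt.fun_sum hP).const_mul β

/-- `d/dθ E(θ) = E(θ) · β Σ_P (−sin(θ + a P))`. -/
theorem hasDerivAt_linkWeight (β : ℝ) (J : Finset ι) (a : ι → ℝ) (θ : ℝ) :
    HasDerivAt (linkWeight β J a) (linkWeight β J a θ * (β * ∑ P ∈ J, -Real.sin (θ + a P))) θ := by
  unfold linkWeight
  exact (hasDerivAt_betaCosSum β J a θ).exp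

/-- `Σ_P (−sin(θ + a P)) = − linkSinSum`. -/
theorem sum_neg_sin_eq (J : Finset ι) (a : ι → ℝ) (θ : ℝ) :
    ∑ P ∈ J, -Real.sin (θ + a P) = -linkSinSum J a θ := by
  unfold linkSinSum
  rw [Finset.sum_neg_distrib]

/-- `d/dθ [sin(θ + a P₀) · E(θ)] = Re-density`. -/
theorem hasDerivAt_sin_mul_linkWeight (β : ℝ) (J : Finset ι) (a : ι → ℝ) (P₀ : ι) (θ : ℝ) :
    HasDerivAt (fun x => Real.sin (x + a P₀) * linkWeight β J a x) (sdReDensity β J a P₀ θ) θ := by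
  have hs : HasDerivAt (fun x => Real.sin (x + a P₀)) (Real.cos (θ + a P₀)) θ := by
    have h : HasDerivAt (fun x => Real.sin (x + a P₀)) (Real.cos (θ + a P₀) * 1) θ :=
      ((hasDerivAt_id θ).add_const (a P₀)).sin
    simpa using h
  have h := hs.mul (hasDerivAt_linkWeight β J a θ)
  have heq : sdReDensity β J a P₀ θ
      = Real.cos (θ + a P₀) * linkWeight β J a θ
        + Real.sin (θ + a P₀) * (linkWeight β J a θ * (β * ∑ P ∈ J, -Real.sin (θ + a P))) := by
    rw [sum_neg_sin_eq]; unfold sdReDensity; ring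
  rw [heq]
  exact h

/-- `d/dθ [cos(θ + a P₀) · E(θ)] = −Im-density`. -/
theorem hasDerivAt_cos_mul_linkWeight (β : ℝ) (J : Finset ι) (a : ι → ℝ) (P₀ : ι) (θ : ℝ) :
    HasDerivAt (fun x => Real.cos (x + a P₀) * linkWeight β J a x) (-sdImDensity β J a P₀ θ) θ := by
  have hc : HasDerivAt (fun x => Real.cos (x + a P₀)) (-Real.sin (θ + a P₀)) θ := by
    have h : HasDerivAt (fun x => Real.cos (x + a P₀)) (-Real.sin (θ + a P₀) * 1) θ :=
      ((hasDerivAt_id θ).add_const (a P₀)).cos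
    simpa using h
  have h := hc.mul (hasDerivAt_linkWeight β J a θ)
  have heq : -sdImDensity β J a P₀ θ
      = -Real.sin (θ + a P₀) * linkWeight β J a θ
        + Real.cos (θ + a P₀) * (linkWeight β J a θ * (β * ∑ P ∈ J, -Real.sin (θ + a P))) := by
    rw [sum_neg_sin_eq]; unfold sdImDensity; ring
  rw [heq]
  exact h

/-- The link weight is continuous in `θ`. -/
theorem continuous_linkWeight (β : ℝ) (J : Finset ι) (a : ι → ℝ) : Continuous (linkWeight β J a) := by
  unfold linkWeight
  fun_prop

/-- The sine sum is continuous in `θ`. -/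
theorem continuous_linkSinSum (J : Finset ι) (a : ι → ℝ) : Continuous (linkSinSum J a) := by
  unfold linkSinSum
  fun_prop

/-- The real residual density is continuous in `θ`. -/
theorem continuous_sdReDensity (β : ℝ) (J : Finset ι) (a : ι → ℝ) (P₀ : ι) :
    Continuous (sdReDensity β J a P₀) := by
  have h1 := continuous_linkWeight β J a
  have h2 := continuous_linkSinSum J a
  unfold sdReDensity
  fun_prop

/-- The imaginary residual density is continuous in `θ`. -/
theorem continuous_sdImDensity (β : ℝ) (J : Finset ι) (a : ι → ℝ) (P₀ : ι) :
    Continuous (sdImDensity β J a P₀) := by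
  have h1 := continuous_linkWeight β J a
  have h2 := continuous_linkSinSum J a
  unfold sdImDensity
  fun_prop

/-- The link weight is `2π`-periodic: `E(2π) = E(0)`. -/
theorem linkWeight_two_pi (β : ℝ) (J : Finset ι) (a : ι → ℝ) :
    linkWeight β J a (2 * π) = linkWeight β J a 0 := by
  unfold linkWeight
  congr 1
  congr 1
  refine Finset.sum_congr rfl ?_
  intro P _
  rw [zero_add, add_comm, Real.cos_add_two_pi]

/-- **Per-link Schwinger–Dyson identity, real part.**  For every `β`, every finite set `J` of
plaquettes through the link with environments `a`, and every `P₀`: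
`∫_0^{2π} [cos(θ + a P₀) − β (Σ_{P∈J} sin(θ + a P)) sin(θ + a P₀)] e^{β Σ_{P∈J} cos(θ + a P)} dθ = 0`. -/
theorem integral_sdRe_link (β : ℝ) (J : Finset ι) (a : ι → ℝ) (P₀ : ι) :
    ∫ θ in (0 : ℝ)..(2 * π), sdReDensity β J a P₀ θ = 0 := by
  rw [integral_eq_sub_of_hasDerivAt (f := fun x => Real.sin (x + a P₀) * linkWeight β J a x)
    (fun θ _ => hasDerivAt_sin_mul_linkWeight β J a P₀ θ)
    ((continuous_sdReDensity β J a P₀).intervalIntegrable _ _)]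
  simp only [zero_add]
  rw [linkWeight_two_pi, add_comm, Real.sin_add_two_pi, sub_self]

/-- **Per-link Schwinger–Dyson identity, imaginary part.**
`∫_0^{2π} [sin(θ + a P₀) + β (Σ_{P∈J} sin(θ + a P)) cos(θ + a P₀)] e^{β Σ_{P∈J} cos(θ + a P)} dθ = 0`. -/
theorem integral_sdIm_link (β : ℝ) (J : Finset ι) (a : ι → ℝ) (P₀ : ι) :
    ∫ θ in (0 : ℝ)..(2 * π), sdImDensity β J a P₀ θ = 0 := by
  have hneg : ∫ θ in (0 : ℝ)..(2 * π), -sdImDensity β J a P₀ θ = 0 := by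
    rw [integral_eq_sub_of_hasDerivAt (f := fun x => Real.cos (x + a P₀) * linkWeight β J a x)
      (fun θ _ => hasDerivAt_cos_mul_linkWeight β J a P₀ θ)
      ((continuous_sdImDensity β J a P₀).neg.intervalIntegrable _ _)]
    simp only [zero_add]
    rw [linkWeight_two_pi, add_comm, Real.cos_add_two_pi, sub_self]
  have h := intervalIntegral.integral_neg (f := sdImDensity β J a P₀) (μ := volume) (a := 0) (b := 2 * π)
  rw [h] at hneg
  exact neg_eq_zero.mp hneg

/-- The engine records the AVERAGE of the residual over the plaquettes `P₀ ∈ J` through the link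
(`latflow.equiv.sd.u1_sd_residual_field`); its weighted integral vanishes too (real part). -/
theorem integral_sdRe_linkMean (β : ℝ) (J : Finset ι) (a : ι → ℝ) :
    ∫ θ in (0 : ℝ)..(2 * π), (∑ P₀ ∈ J, sdReDensity β J a P₀ θ) / J.card = 0 := by
  have hint : ∀ P₀ ∈ J, IntervalIntegrable (sdReDensity β J a P₀) volume 0 (2 * π) :=
    fun P₀ _ => (continuous_sdReDensity β J a P₀).intervalIntegrable _ _
  rw [intervalIntegral.integral_div, intervalIntegral.integral_finsetSum hint]
  rw [Finset.sum_eq_zero (fun P₀ _ => integral_sdRe_link β J a P₀), zero_div]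

/-- Same for the imaginary part of the per-link average. -/
theorem integral_sdIm_linkMean (β : ℝ) (J : Finset ι) (a : ι → ℝ) :
    ∫ θ in (0 : ℝ)..(2 * π), (∑ P₀ ∈ J, sdImDensity β J a P₀ θ) / J.card = 0 := by
  have hint : ∀ P₀ ∈ J, IntervalIntegrable (sdImDensity β J a P₀) volume 0 (2 * π) :=
    fun P₀ _ => (continuous_sdImDensity β J a P₀).intervalIntegrable _ _
  rw [intervalIntegral.integral_div, intervalIntegral.integral_finsetSum hint]
  rw [Finset.sum_eq_zero (fun P₀ _ => integral_sdIm_link β J a P₀), zero_div]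

/-- The one-link partition function `Z_l = ∫_0^{2π} E(θ) dθ`. -/
noncomputable def linkZ (β : ℝ) (J : Finset ι) (a : ι → ℝ) : ℝ :=
  ∫ θ in (0 : ℝ)..(2 * π), linkWeight β J a θ

/-- `Z_l > 0`. -/
theorem linkZ_pos (β : ℝ) (J : Finset ι) (a : ι → ℝ) : 0 < linkZ β J a := by
  unfold linkZ
  refine intervalIntegral_pos_of_pos_on ?_ (fun x _ => by unfold linkWeight; exact Real.exp_pos _)
    (by positivity)
  exact (continuous_linkWeight β J a).intervalIntegrable _ _

/-- The conditional (one-link) expectation `⟨f⟩_l = (1/Z_l) ∫_0^{2π} f(θ) E(θ) dθ`. -/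
noncomputable def linkExpect (β : ℝ) (J : Finset ι) (a : ι → ℝ) (f : ℝ → ℝ) : ℝ :=
  (∫ θ in (0 : ℝ)..(2 * π), f θ * linkWeight β J a θ) / linkZ β J a

/-- **`⟨Re R_{l,P₀}⟩_l = 0`** — the conditional expectation of the real residual given the environment. -/
theorem linkExpect_sdRe_eq_zero (β : ℝ) (J : Finset ι) (a : ι → ℝ) (P₀ : ι) :
    linkExpect β J a (fun θ => Real.cos (θ + a P₀) - β * linkSinSum J a θ * Real.sin (θ + a P₀)) = 0 := by
  unfold linkExpect
  have h : (fun θ => (Real.cos (θ + a P₀) - β * linkSinSum J a θ * Real.sin (θ + a P₀)) * linkWeight β J a θ)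
      = sdReDensity β J a P₀ := by
    funext θ; rfl
  rw [h, integral_sdRe_link, zero_div]

/-- **`⟨Im R_{l,P₀}⟩_l = 0`**. -/
theorem linkExpect_sdIm_eq_zero (β : ℝ) (J : Finset ι) (a : ι → ℝ) (P₀ : ι) :
    linkExpect β J a (fun θ => Real.sin (θ + a P₀) + β * linkSinSum J a θ * Real.cos (θ + a P₀)) = 0 := by
  unfold linkExpect
  have h : (fun θ => (Real.sin (θ + a P₀) + β * linkSinSum J a θ * Real.cos (θ + a P₀)) * linkWeight β J a θ)
      = sdImDensity β J a P₀ := by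
    funext θ; rfl
  rw [h, integral_sdIm_link, zero_div]

/-- Consistency with row 11's one-plaquette file: for a single plaquette with zero environment the
real density is `sdResidualDensity` there, `(cos θ − β sin² θ) e^{β cos θ}` (stated as an equation of
real numbers so that this file does not import that one). -/
theorem sdReDensity_singleton (β θ : ℝ) (P₀ : ι) :
    sdReDensity β ({P₀} : Finset ι) (fun _ => 0) P₀ θ
      = (Real.cos θ - β * Real.sin θ ^ 2) * Real.exp (β * Real.cos θ) := by
  unfold sdReDensity linkSinSum linkWeight
  simp only [Finset.sum_singleton, add_zero]
  ring

end Summit.Ventures.LatticeQCDFlow.Scoring
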